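import Summits.HodgeConjecture.HodgeConjecture.Theorems.VHCAbelianSchemesRoadSecantQuotientAnchorPinnedDefs
import Literature.AlgebraicGeometry.HodgeTheory.WeilClassesSquareDivisorPolynomial
import Literature.AlgebraicGeometry.HodgeTheory.HodgeClassesIsogenyInvariance
import Literature.AlgebraicGeometry.HodgeTheory.LefschetzOneOneHolds
import Literature.AlgebraicGeometry.HodgeTheory.AbelianLowDimensionWeilReductionProofs
import Literature.AlgebraicGeometry.HodgeTheory.AmpleDivisorClassHardLefschetz
import Literature.AlgebraicGeometry.HodgeTheory.AmpleDivisorChernClassNeZero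
import Literature.AlgebraicGeometry.HodgeTheory.IsoTransport
import Literature.AlgebraicGeometry.HodgeTheory.WeilClassesCyclicPrymDimension
import Literature.AlgebraicGeometry.HodgeTheory.HodgeRiemannDegreeOneProofs
import Literature.AlgebraicGeometry.Motives.AimedSplitProductProofs
import HarnessLib

/-!
# Road b02 (`VHCAbelianSchemesRoad`, D-0059) — every SERVED CLASS of the secant–quotient anchor data is an ALGEBRAIC
# LEFSCHETZ class of its anchor (crux `SemiregularSheafRepresentativesTwAtDiag`, item stmt-HodgeConjecture-19787,
# skeleton v3.1, stub 2a″ `stub_anchorCarrier_63_secantQuotientPinned` and its served sets `𝔖`, `𝔖^pin`)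

research route conditional on HC_CM; not a corollary; Q11.4-sentence-2 already refuted in dim ≥ 3.

THEOREMS ONLY (fact-free; no definition; no claim-tagged fact imported; `HC_CM` nowhere). The anchor data of the `(6,3)` rung
— v3's `(secantQuotientAnchors, secantQuotientServedClasses)` (`…SecantQuotientAnchorDefs`, p506550) and v3.1's PINNED pair
`(secantQuotientAnchorsPinned, secantQuotientServedClassesPinned)` (`…SecantQuotientAnchorPinnedDefs`, p512578) — serve, at a chart
`e : X ≅ D.Y.X` of a secant quotient `Y_d = (J × Ĵ)/Ḡ`, the rational classes `γ ∉ ℂ·θ³` with `q^*(e⁻¹)^*γ` in the (complexified)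
Weil plane `weilClassesOf D.P D.ψ 3 D.d` of `(J × Ĵ, φ_d)`. This file records the one structural fact about these classes that the
tree already proves and the card of the line had not spelled out:

**`𝔖 X θ ⊆ D³(X) ⊗ ℂ ∩ N³H⁶(X)` — every served class is a `ℂ`-combination of triple cup products of rational `(1,1)`-classes of
the anchor, in particular ALGEBRAIC on the anchor** (`IsSecantQuotientWeilClassAt.mem_divisorClassesSpan` / `.mem_algebraicClasses`,
and the pinned forms). Assembly, tree theorems only:

* §1 `weilClassesOf_weilOperator_le_divisorClassesSpan`: for ANY principally polarised abelian `g`-fold `(A, Θ)` and `d ≥ 1`, the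
  Weil plane of F4's split structure `(A × Â, φ_d)`, `φ_d(x, y) = (−d·φ_Θ⁻¹ y, φ_Θ x)` (`Markman2025.weilOperator`), lies in
  `Dᵍ(A × Â) ⊗ ℂ` — the tree's abstract square theorem `HodgeTheory.weilClassesOf_le_divisorClassesSpan_of_intertwining` (Deligne,
  LNM 900, Lemma 4.5 / Remark 4.10: `E_± = ℂ·Ω_±^g` with `Ω_±` a `ℚ(i√d)`-combination of pull-backs of a polarisation class along
  homomorphisms) instantiated with `q₂ = p₁`, `q₁ = φ_d ≫ p₁`, the section `(𝟙, 0) : A → A × Â`, and `Θ = p₁^*θ_A` for a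
  polarisation class `θ_A` of `Θ` (`θ_A^g ≠ 0` by hard Lefschetz, `cupPowTwo_ne_zero_of_hasHardLefschetzProperty`); the datum's
  instance `SecantQuotientDatum.weilClassesOf_le_divisorClassesSpan` (`(J × Ĵ, φ_d)`, `g = 3`).
* §2 descent along the isogeny `q : J × Ĵ → Y_d` (`not_mem_divisorClassesSpan_map_of_isIsogeny`: exceptional classes stay
  exceptional along an isogeny) and Lefschetz `(1,1)` (`lefschetzOneOne_rational_holds`) for algebraicity on `Y_d`.
* §3 transport along the chart `e` (`map_mem_divisorClassesSpan`, `mem_algebraicClasses_map_iff_of_iso`); the served sets.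

CONSEQUENCES BY NAME (§4–§6), for the bookkeeping of the line (nothing here narrows a stub or asserts a cell):
* §4 a served fibre `sₐ` of `HasServedFibre 6 3 𝔄 𝔖 f W` (v3 or pinned data) has `W|_{sₐ}` ALGEBRAIC-LEFSCHETZ: on a served pencil of
  regime 2 the exceptional fibre is never the served fibre (Markman's design read in the road's words: the class is a divisor
  polynomial AT `X × X̂` and exceptional at the general Weil-type member, Thm. 1.4.1 / Thm. 1.5.1).
* §5 the hypothesis «a served rational ALGEBRAIC class `w ∉ Dᵖ(X) ⊗ ℂ` at an anchor» of PART Z-c's necessity and non-vacuity theorems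
  (`…ServedFibreAnchors.exists_designModLefschetz_at_anchor_of_under_hasServedFibre`, `exists_servedPencil_of_anchor`,
  `not_forall_not_hasServedFibre_of_anchor`) is UNSATISFIABLE for the secant–quotient data: the through-anchor piece of the `(6,3)`
  cell, hence the rung, forces NO datum at its own anchors by constant pencils, and the non-vacuity of 2a″'s piece inside regime 2
  needs a non-isotrivial family (which is why P1 p509795 / P1″ p513733 carry the displayed supply `SecantAnchorWeilPencilSupply`).
* §6 `SecantQuotientAnchorCarrier63Pinned C` ⟸ «carriers for the rational, algebraic, off-ray LEFSCHETZ classes at the pinned anchors»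
  (`anchoredCarrierAt_anti`): the excess (G3) of stub 2a″ over print is a statement about rational points of `ℚθ³ ⊕ HW_ℚ ⊂ D³(Y_d)`,
  directions of a SPECIAL sixfold that become exceptional only off the anchor.

What is NOT claimed: (2a″), (2b″), the rung, any cell, K-SR♭∃, VHC, `HC_AV`, HC; that `D³(Y_d)` is spanned by the served classes;
anything about carriers. References: [cite: Deligne1982HodgeCycles, §4 Lemma 4.5 and Remark 4.10] [cite: vanGeemen1994HodgeAV, §2.4,
§3.6 (p. 236), 4.9 and Thm. 4.11] [cite: Markman2025SecantWeil, §1.5 (p. 7), §3.2, Thm. 1.4.1 and Thm. 1.5.1]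
[cite: VoisinHodgeI2002, Thm. 6.25 and Thm. 11.30] [cite: Bloch1972Semiregularity, Remark (7.5)].
-/

noncomputable section

open CategoryTheory CategoryTheory.Limits AlgebraicGeometry Topology

namespace Summit.HodgeConjecture.HodgeConjecture.Ring2.SemiregularRepresentatives

set_option linter.dupNamespace false -- the cell's namespace repeats the summit name, as in every `Ring2*` file

open Literature.AlgebraicGeometry Literature.AlgebraicGeometry.Motives Literature.AlgebraicGeometry.Motives.AbelianVariety
open Literature.AlgebraicGeometry.HodgeTheory Literature.AlgebraicGeometry.Markman2025
open Literature.AlgebraicTopology.SingularHomology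
open Literature.Barriers.HodgeConjecture (divisorClassesSpan)
open Literature.Geometry.Kaehler (HasHardLefschetzProperty lefschetzPow)

/-! ## §0 Hard Lefschetz in dimension `n` forces `θⁿ ≠ 0` -/

/-- **`θⁿ ≠ 0` for a class with the hard Lefschetz property in dimension `n`** on a smooth projective `X` of dimension `n`:
`Lⁿ : H⁰ → H²ⁿ`, `y ↦ y ⌣ θⁿ`, is injective and `H⁰(X(ℂ); ℂ)` is a line. [cite: VoisinHodgeI2002, Thm. 6.25] [cite: HatcherAT2002, §3.1 p. 199] -/
theorem cupPowTwo_ne_zero_of_hasHardLefschetzProperty {n : ℕ} {X : SchemeOver ℂ} (hX : IsSmoothProjective n X)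
    {θ : complexBetti X 2} (hθ : HasHardLefschetzProperty θ n) : cupPowTwo θ n ≠ 0 := by
  intro h0
  have hinj := (hθ n 0 (Nat.zero_add n)).1
  have h1 : Module.finrank ℂ (complexBetti X 0) = 1 := finrank_complexBetti_zero hX
  obtain ⟨y, hy⟩ : ∃ y : complexBetti X 0, y ≠ 0 := by
    by_contra h
    push Not at h
    haveI : Subsingleton (complexBetti X 0) := subsingleton_of_forall_eq 0 h
    rw [Module.finrank_zero_of_subsingleton] at h1
    exact zero_ne_one h1
  refine hy (hinj ?_)
  rw [map_zero, HodgeRiemannDegreeOne.lefschetzPow_eq_cupProduct_cupPowTwo, h0, map_zero]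

/-! ## §1 The Weil plane of the split Weil structure `φ_d` on `A × Â` (principal `Θ`) is a divisor polynomial -/

section SplitAnchor

variable (A : AbelianVariety ℂ) {Θ : CartierDivisor A.X.left} (hΘ : Θ.IsAmple) (hK : A.KTheta Θ = ⊥) (d : ℕ)

/-- `φ_d ≫ φ_d = −(d • 𝟙)` on `A × Â`, with a natural-number scalar. [cite: Markman2025SecantWeil, §3.2] -/
theorem weilOperator_comp_self_nsmul :
    weilOperator hΘ hK d ≫ weilOperator hΘ hK d = -(d • 𝟙 (A.prod (A.dualOf Θ hΘ))) := by
  rw [weilOperator_comp_self, natCast_zsmul]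

/-- The intertwining relation `φ_d ≫ (φ_d ≫ p₁) = −(d • p₁)`. [cite: Markman2025SecantWeil, §3.2] -/
theorem weilOperator_comp_weilOperator_comp_fst :
    weilOperator hΘ hK d ≫ (weilOperator hΘ hK d ≫ AbelianVariety.fst A (A.dualOf Θ hΘ)) =
      -(d • AbelianVariety.fst A (A.dualOf Θ hΘ)) := by
  rw [← Category.assoc, weilOperator_comp_self_nsmul, Preadditive.neg_comp, Preadditive.nsmul_comp, Category.id_comp]

/-- The section `(𝟙, 0) : A → A × Â` is killed by `φ_d ≫ p₁ = −d·(p₂ ≫ φ_Θ⁻¹)`. [cite: Markman2025SecantWeil, §3.2] -/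
theorem sect_comp_weilOperator_comp_fst :
    AbelianVariety.prodLift (𝟙 A) (0 : A ⟶ A.dualOf Θ hΘ) ≫ (weilOperator hΘ hK d ≫ AbelianVariety.fst A (A.dualOf Θ hΘ)) = 0 := by
  rw [weilOperator_fst, Preadditive.comp_neg, Preadditive.comp_zsmul, ← Category.assoc, AbelianVariety.prodLift_snd, zero_comp,
    smul_zero, neg_zero]

/-- **`L_c = (φ_d ≫ p₁)^* + c·p₁^*` is injective on `H¹(A)`** for `c ≠ 0`: pull back along the section `(𝟙, 0)`.
[cite: Deligne1982HodgeCycles, §4 Lemma 4.5] -/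
theorem weilOperator_virtual_injective {c : ℂ} (hc : c ≠ 0) (v : complexBetti A.X 1)
    (hv : complexBetti.map (weilOperator hΘ hK d ≫ AbelianVariety.fst A (A.dualOf Θ hΘ)).hom.hom.hom 1 v +
      c • complexBetti.map (AbelianVariety.fst A (A.dualOf Θ hΘ)).hom.hom.hom 1 v = 0) :
    v = 0 := by
  have h := congrArg (complexBetti.map (AbelianVariety.prodLift (𝟙 A) (0 : A ⟶ A.dualOf Θ hΘ)).hom.hom.hom 1) hv
  rw [map_add, map_smul, complexBetti_map_map_hom, complexBetti_map_map_hom, sect_comp_weilOperator_comp_fst,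
    AbelianVariety.prodLift_fst, complexBetti_map_zero_deg_one, zero_add, map_zero] at h
  have h' : c • v = 0 := by
    rw [← abelianVariety_map_id_apply v]
    exact h
  exact (smul_eq_zero.1 h').resolve_left hc

variable {A d}

/-- **THE WEIL PLANE OF `(A × Â, φ_d)` LIES IN `Dᵍ(A × Â) ⊗ ℂ`** for a principally polarised abelian `g`-fold `A` (`g, d ≥ 1`):
`weilClassesOf (A × Â) φ_d g d ≤ divisorClassesSpan (A × Â) (2g) g` — the Weil classes of Markman's split anchor are polynomials
in divisor classes (Deligne's square: `E_± = ℂ·Ω_±^g`, `Ω_± = R ± i√d·S` with `R`, `S` rational divisor classes), by the tree's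
`weilClassesOf_le_divisorClassesSpan_of_intertwining` at `q₂ = p₁`, `q₁ = φ_d ≫ p₁`, `s = (𝟙, 0)`, `Θ = p₁^*θ_A` for a polarisation
class `θ_A` of `Θ` (`θ_A^g ≠ 0` by hard Lefschetz). [cite: Deligne1982HodgeCycles, §4 Lemma 4.5 and Remark 4.10]
[cite: vanGeemen1994HodgeAV, §2.4 and 4.9] [cite: Markman2025SecantWeil, §3.2 and Thm. 1.4.1] -/
theorem weilClassesOf_weilOperator_le_divisorClassesSpan {g : ℕ} (hg : 0 < g) (hA : A.dim = g) (hd : 0 < d) :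
    weilClassesOf (A.prod (A.dualOf Θ hΘ)) (weilOperator hΘ hK d) g d ≤ divisorClassesSpan (A.prod (A.dualOf Θ hΘ)).X (2 * g) g := by
  have hA1 : 1 ≤ A.dim := by rw [hA]; exact hg
  have hAsp : IsSmoothProjective g A.X := hA ▸ AbelianVariety.isSmoothProjective_holds (A := A)
  have hP : (A.prod (A.dualOf Θ hΘ)).dim = 2 * g := by
    rw [AbelianVariety.dim_prod, AbelianVariety.dim_dualOf, hA]; ring
  have hPsp : IsSmoothProjective (2 * g) (A.prod (A.dualOf Θ hΘ)).X := hP ▸ AbelianVariety.isSmoothProjective_holds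
  obtain ⟨θA, hθA⟩ := A.exists_isPolarizationClassOf_of_isAmple hA1 hΘ
  have hHL : HasHardLefschetzProperty θA g := hA ▸ (hθA.isPolarizationClass hΘ).hasHardLefschetz
  have hθg : cupPowTwo θA g ≠ 0 := cupPowTwo_ne_zero_of_hasHardLefschetzProperty hAsp hHL
  have hinj : ∀ (c : ℂ) (v : complexBetti A.X 1), c * c = -(d : ℂ) →
      complexBetti.map (weilOperator hΘ hK d ≫ AbelianVariety.fst A (A.dualOf Θ hΘ)).hom.hom.hom 1 v +
        c • complexBetti.map (AbelianVariety.fst A (A.dualOf Θ hΘ)).hom.hom.hom 1 v = 0 → v = 0 := by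
    intro c v hc hv
    refine weilOperator_virtual_injective A hΘ hK d ?_ v hv
    rintro rfl
    rw [zero_mul, eq_comm, neg_eq_zero, Nat.cast_eq_zero] at hc
    omega
  have hΘQ : IsRationalClass (complexBetti.map (AbelianVariety.fst A (A.dualOf Θ hΘ)).hom.hom.hom 2 θA) :=
    hθA.isRationalClass.pullback _
  have hΘ11 : IsOfHodgeType (2 * g) (A.prod (A.dualOf Θ hΘ)).X 2 1 1
      (complexBetti.map (AbelianVariety.fst A (A.dualOf Θ hΘ)).hom.hom.hom 2 θA) :=
    (hA ▸ hθA.isOfHodgeType).map_of_isSmoothProjective hPsp hAsp _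
  have hsΘ : cupPowTwo (complexBetti.map (AbelianVariety.prodLift (𝟙 A) (0 : A ⟶ A.dualOf Θ hΘ)).hom.hom.hom 2
      (complexBetti.map (AbelianVariety.fst A (A.dualOf Θ hΘ)).hom.hom.hom 2 θA)) g ≠ 0 := by
    rw [complexBetti_map_map_hom, AbelianVariety.prodLift_fst]
    have e2 : complexBetti.map (𝟙 A : A ⟶ A).hom.hom.hom 2 θA = θA := abelianVariety_map_id_apply θA
    rw [e2]
    exact hθg
  exact weilClassesOf_le_divisorClassesSpan_of_intertwining (A := A.prod (A.dualOf Θ hΘ)) (T := A) (g := g) (d := d)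
    (Φ := weilOperator hΘ hK d) (q₁ := weilOperator hΘ hK d ≫ AbelianVariety.fst A (A.dualOf Θ hΘ))
    (q₂ := AbelianVariety.fst A (A.dualOf Θ hΘ)) hg hA hP hd (weilOperator_comp_self_nsmul A hΘ hK d) rfl
    (weilOperator_comp_weilOperator_comp_fst A hΘ hK d) hinj _ hΘQ hΘ11 hsΘ

end SplitAnchor

namespace SecantQuotientDatum

variable (D : SecantQuotientDatum)

/-- **THE WEIL PLANE OF MARKMAN'S `(J × Ĵ, φ_d)` LIES IN `D³(J × Ĵ) ⊗ ℂ`**: `weilClassesOf D.P D.ψ 3 D.d ≤ divisorClassesSpan D.P.X 6 3`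
(the datum's instance of `weilClassesOf_weilOperator_le_divisorClassesSpan`). [cite: Deligne1982HodgeCycles, §4 Lemma 4.5 and Remark 4.10]
[cite: Markman2025SecantWeil, §1.5 (p. 7), §3.2 and Thm. 1.4.1] -/
theorem weilClassesOf_le_divisorClassesSpan : weilClassesOf D.P D.ψ 3 D.d ≤ divisorClassesSpan D.P.X 6 3 :=
  weilClassesOf_weilOperator_le_divisorClassesSpan D.isAmple D.KTheta_eq_bot (by norm_num) D.dim_J
    (by have := D.four_le; omega)

/-! ## §2 Descent along `q : J × Ĵ → Y_d` and Lefschetz `(1,1)` on `Y_d` -/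

/-- **A class on `Y_d` whose pull-back `q^*γ` is a Weil class of `(J × Ĵ, φ_d)` is an algebraic-LEFSCHETZ class of `Y_d`**:
`γ ∈ D³(Y_d) ⊗ ℂ` (exceptional classes stay exceptional along the isogeny `q`, `not_mem_divisorClassesSpan_map_of_isIsogeny`, and
`q^*γ ∈ W_K ⊗ ℂ ⊆ D³(J × Ĵ) ⊗ ℂ`). [cite: vanGeemen1994HodgeAV, §2.4 and §3.6 (p. 236)] [cite: Deligne1982HodgeCycles, §4 Remark 4.10] -/
theorem mem_divisorClassesSpan_of_map_q_mem_weilClassesOf {γ : complexBetti D.Y.X (2 * 3)}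
    (hγ : complexBetti.map D.q.hom.hom.hom (2 * 3) γ ∈ weilClassesOf D.P D.ψ 3 D.d) :
    γ ∈ divisorClassesSpan D.Y.X 6 3 := by
  by_contra hnot
  have h1 : γ ∉ divisorClassesSpan D.Y.X D.Y.dim 3 := by rwa [D.dim_Y]
  have h2 := not_mem_divisorClassesSpan_map_of_isIsogeny D.isIsogeny_q h1
  rw [D.dim_P] at h2
  exact h2 (D.weilClassesOf_le_divisorClassesSpan hγ)

/-- `D³(Y_d) ⊗ ℂ ⊆ N³H⁶(Y_d)`: algebraic-Lefschetz classes of the secant quotient are ALGEBRAIC (Lefschetz `(1,1)`,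
`lefschetzOneOne_rational_holds`, and products of divisor classes). [cite: VoisinHodgeI2002, Thm. 11.30] [cite: vanGeemen1994HodgeAV, §2.4] -/
theorem divisorClassesSpan_Y_le_algebraicClasses (p : ℕ) : divisorClassesSpan D.Y.X 6 p ≤ algebraicClasses D.Y.X p :=
  AbelianVariety.divisorClassesSpan_le_algebraicClasses D.Y
    (fun b hb hb' ↦ lefschetzOneOne_rational_holds D.isSmoothProjective_Y b hb hb') p

/-- Hence such a `γ` is ALGEBRAIC on `Y_d`. [cite: VoisinHodgeI2002, Thm. 11.30] [cite: vanGeemen1994HodgeAV, §2.4] -/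
theorem mem_algebraicClasses_of_map_q_mem_weilClassesOf {γ : complexBetti D.Y.X (2 * 3)}
    (hγ : complexBetti.map D.q.hom.hom.hom (2 * 3) γ ∈ weilClassesOf D.P D.ψ 3 D.d) :
    γ ∈ algebraicClasses D.Y.X 3 :=
  D.divisorClassesSpan_Y_le_algebraicClasses 3 (D.mem_divisorClassesSpan_of_map_q_mem_weilClassesOf hγ)

end SecantQuotientDatum

/-! ## §3 At a chart: every served class is an algebraic Lefschetz class of the anchor -/

variable {X : SchemeOver ℂ} {θ : complexBetti X 2} {γ : complexBetti X (2 * 3)}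

namespace IsSecantQuotientWeilClassAt

/-- **A secant–quotient Weil class is an algebraic-LEFSCHETZ class of its anchor: `γ ∈ D³(X) ⊗ ℂ`** (v3's predicate; transport
of §2 along the chart `e : X ≅ D.Y.X`). [cite: Deligne1982HodgeCycles, §4 Remark 4.10] [cite: vanGeemen1994HodgeAV, §2.4 and §3.6 (p. 236)]
[cite: Markman2025SecantWeil, Thm. 1.4.1] -/
theorem mem_divisorClassesSpan (h : IsSecantQuotientWeilClassAt X θ γ) : γ ∈ divisorClassesSpan X 6 3 := by
  have hX : IsSmoothProjective 6 X := h.isSmoothProjective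
  obtain ⟨D, e, -, -, -, -, -, hmem⟩ := h
  have hY : complexBetti.map e.inv (2 * 3) γ ∈ divisorClassesSpan D.Y.X 6 3 :=
    D.mem_divisorClassesSpan_of_map_q_mem_weilClassesOf hmem
  have hX' := map_mem_divisorClassesSpan hX D.isSmoothProjective_Y e.hom hY
  rwa [e.complexBetti_map_hom_map_inv] at hX'

/-- **… and it is ALGEBRAIC on the anchor: `γ ∈ N³H⁶(X)`.** [cite: VoisinHodgeI2002, Thm. 11.30] [cite: vanGeemen1994HodgeAV, §2.4] -/
theorem mem_algebraicClasses (h : IsSecantQuotientWeilClassAt X θ γ) : γ ∈ algebraicClasses X 3 := by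
  obtain ⟨D, e, -, -, -, -, -, hmem⟩ := h
  have hY : complexBetti.map e.inv (2 * 3) γ ∈ algebraicClasses D.Y.X 3 :=
    D.mem_algebraicClasses_of_map_q_mem_weilClassesOf hmem
  have hX' := (mem_algebraicClasses_map_iff_of_iso e).2 hY
  rwa [e.complexBetti_map_hom_map_inv] at hX'

/-- A served class is of Hodge type `(3,3)` on the anchor (it is algebraic). [cite: VoisinHodgeI2002, §11.1.2] -/
theorem isOfHodgeType (h : IsSecantQuotientWeilClassAt X θ γ) : IsOfHodgeType 6 X (2 * 3) 3 3 γ :=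
  isOfHodgeType_of_mem_algebraicClasses_of_isSmoothProjective h.isSmoothProjective 3 h.mem_algebraicClasses

end IsSecantQuotientWeilClassAt

namespace IsSecantQuotientWeilClassAtPinned

/-- **A PINNED secant–quotient Weil class is an algebraic-Lefschetz class of its anchor** (the pin is not used).
[cite: Deligne1982HodgeCycles, §4 Remark 4.10] [cite: Markman2025SecantWeil, Thm. 1.4.1] -/
theorem mem_divisorClassesSpan (h : IsSecantQuotientWeilClassAtPinned X θ γ) : γ ∈ divisorClassesSpan X 6 3 :=
  h.toAt.mem_divisorClassesSpan

/-- … and algebraic on the anchor. [cite: VoisinHodgeI2002, Thm. 11.30] -/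
theorem mem_algebraicClasses (h : IsSecantQuotientWeilClassAtPinned X θ γ) : γ ∈ algebraicClasses X 3 :=
  h.toAt.mem_algebraicClasses

/-- … and of Hodge type `(3,3)`. [cite: VoisinHodgeI2002, §11.1.2] -/
theorem isOfHodgeType (h : IsSecantQuotientWeilClassAtPinned X θ γ) : IsOfHodgeType 6 X (2 * 3) 3 3 γ :=
  h.toAt.isOfHodgeType

end IsSecantQuotientWeilClassAtPinned

/-- **`𝔖 X θ ⊆ D³(X) ⊗ ℂ ∩ N³H⁶(X)`** for v3's served set. [cite: Deligne1982HodgeCycles, §4 Remark 4.10] [cite: vanGeemen1994HodgeAV, §2.4] -/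
theorem secantQuotientServedClasses_subset_lefschetz (X : SchemeOver ℂ) (θ : complexBetti X 2) :
    secantQuotientServedClasses X θ ⊆
      {w | w ∈ divisorClassesSpan X 6 3 ∧ w ∈ algebraicClasses X 3 ∧ IsRationalClass w ∧ w ∉ (ℂ ∙ cupPowTwo θ 3)} :=
  fun _ hw ↦ ⟨IsSecantQuotientWeilClassAt.mem_divisorClassesSpan hw, IsSecantQuotientWeilClassAt.mem_algebraicClasses hw,
    IsSecantQuotientWeilClassAt.isRationalClass hw, IsSecantQuotientWeilClassAt.not_mem_span hw⟩

/-- **`𝔖^pin X θ ⊆ D³(X) ⊗ ℂ ∩ N³H⁶(X)`** for v3.1's pinned served set. [cite: Deligne1982HodgeCycles, §4 Remark 4.10] [cite: vanGeemen1994HodgeAV, §2.4] -/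
theorem secantQuotientServedClassesPinned_subset_lefschetz (X : SchemeOver ℂ) (θ : complexBetti X 2) :
    secantQuotientServedClassesPinned X θ ⊆
      {w | w ∈ divisorClassesSpan X 6 3 ∧ w ∈ algebraicClasses X 3 ∧ IsRationalClass w ∧ w ∉ (ℂ ∙ cupPowTwo θ 3)} :=
  fun _ hw ↦ secantQuotientServedClasses_subset_lefschetz X θ (IsSecantQuotientWeilClassAtPinned.toAt hw)

/-! ## §4 A served fibre is an algebraic-Lefschetz fibre of `W` -/

/-- **ON A PENCIL WITH A (v3-)SERVED FIBRE `sₐ`, `W|_{sₐ}` IS ALGEBRAIC-LEFSCHETZ**: the exceptional fibre witnessing regime 2 is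
never the served fibre. [cite: Markman2025SecantWeil, Thm. 1.4.1 and Thm. 1.5.1] [cite: vanGeemen1994HodgeAV, §2.4 and Thm. 4.11] -/
theorem exists_lefschetzFibre_of_hasServedFibre_secantQuotient {𝒳 S : SchemeOver ℂ} {f : 𝒳 ⟶ S}
    {W : complexBetti 𝒳 (2 * 3)}
    (h : HasServedFibre 6 3 (fun X θ ↦ secantQuotientAnchors X θ) (fun X θ ↦ secantQuotientServedClasses X θ) f W) :
    ∃ sₐ : ComplexPoints S,
      complexBetti.map (fiberι f sₐ) (2 * 3) W ∈ algebraicClasses (fiberOver f sₐ) 3 ∧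
      complexBetti.map (fiberι f sₐ) (2 * 3) W ∈ divisorClassesSpan (fiberOver f sₐ) 6 3 := by
  obtain ⟨sₐ, Θ, -, -, -, hW⟩ := h
  exact ⟨sₐ, IsSecantQuotientWeilClassAt.mem_algebraicClasses hW, IsSecantQuotientWeilClassAt.mem_divisorClassesSpan hW⟩

/-- **ON A PENCIL WITH A PINNED-SERVED FIBRE `sₐ`, `W|_{sₐ}` IS ALGEBRAIC-LEFSCHETZ** (skeleton v3.1's partition variable).
[cite: Markman2025SecantWeil, Thm. 1.4.1 and Thm. 1.5.1] [cite: vanGeemen1994HodgeAV, §2.4 and Thm. 4.11] -/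
theorem exists_lefschetzFibre_of_hasServedFibre_secantQuotientPinned {𝒳 S : SchemeOver ℂ} {f : 𝒳 ⟶ S}
    {W : complexBetti 𝒳 (2 * 3)}
    (h : HasServedFibre 6 3 (fun X θ ↦ secantQuotientAnchorsPinned X θ)
      (fun X θ ↦ secantQuotientServedClassesPinned X θ) f W) :
    ∃ sₐ : ComplexPoints S,
      complexBetti.map (fiberι f sₐ) (2 * 3) W ∈ algebraicClasses (fiberOver f sₐ) 3 ∧
      complexBetti.map (fiberι f sₐ) (2 * 3) W ∈ divisorClassesSpan (fiberOver f sₐ) 6 3 := by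
  obtain ⟨sₐ, Θ, -, -, -, hW⟩ := h
  exact ⟨sₐ, IsSecantQuotientWeilClassAtPinned.mem_algebraicClasses hW,
    IsSecantQuotientWeilClassAtPinned.mem_divisorClassesSpan hW⟩

/-! ## §5 PART Z-c's hypothesis «served algebraic NON-Lefschetz class at an anchor» is unsatisfiable for these data -/

/-- **NO v3 anchor carries a served class outside `D³ ⊗ ℂ`** — the hypothesis `hwD : w ∉ divisorClassesSpan X 6 3` of
`exists_designModLefschetz_at_anchor_of_under_hasServedFibre` / `exists_servedPencil_of_anchor` / `not_forall_not_hasServedFibre_of_anchor`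
cannot be met by `(secantQuotientAnchors, secantQuotientServedClasses)`: the through-anchor piece forces no datum at its anchors by
constant pencils, and its non-vacuity inside regime 2 is not witnessed by a constant pencil. [cite: vanGeemen1994HodgeAV, §2.4 and Thm. 4.11]
[cite: Bloch1972Semiregularity, Remark (7.5)] -/
theorem not_exists_served_not_mem_divisorClassesSpan_secantQuotient :
    ¬ ∃ (X : SchemeOver ℂ) (θ : complexBetti X 2) (w : complexBetti X (2 * 3)),
      secantQuotientAnchors X θ ∧ w ∈ secantQuotientServedClasses X θ ∧ w ∉ divisorClassesSpan X 6 3 := by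
  rintro ⟨X, θ, w, -, hw, hwD⟩
  exact hwD (IsSecantQuotientWeilClassAt.mem_divisorClassesSpan hw)

/-- **NO PINNED anchor carries a served class outside `D³ ⊗ ℂ`** (skeleton v3.1's data). [cite: vanGeemen1994HodgeAV, §2.4 and Thm. 4.11]
[cite: Bloch1972Semiregularity, Remark (7.5)] -/
theorem not_exists_served_not_mem_divisorClassesSpan_secantQuotientPinned :
    ¬ ∃ (X : SchemeOver ℂ) (θ : complexBetti X 2) (w : complexBetti X (2 * 3)),
      secantQuotientAnchorsPinned X θ ∧ w ∈ secantQuotientServedClassesPinned X θ ∧ w ∉ divisorClassesSpan X 6 3 := by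
  rintro ⟨X, θ, w, -, hw, hwD⟩
  exact hwD (IsSecantQuotientWeilClassAtPinned.mem_divisorClassesSpan hw)

/-! ## §6 Stub 2a″ from carriers in the rational off-ray LEFSCHETZ directions of the pinned anchors -/

/-- **(2a″) ⟸ «LEFSCHETZ-DIRECTION CARRIERS AT THE PINNED ANCHORS»**: if at every pinned anchor `(X, θ)` every RATIONAL, ALGEBRAIC,
off-ray class of `D³(X) ⊗ ℂ` is served by a datum of the crux's twisted door (`κ₃ = a·w + c·θ³`, sides on the `θ`-ray), then
`SecantQuotientAnchorCarrier63Pinned C` — by `anchoredCarrierAt_anti`, since `𝔖^pin X θ` consists of such classes (§3). An UPPER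
BOUND BY NAME for the excess (G3) of the stub over print: the missing directions are rational points of `ℚθ³ ⊕ HW_ℚ ⊂ D³(Y_d)`.
Nothing says the hypothesis holds. [cite: Markman2025SecantWeil, Thm. 1.4.1 and §1.5] [cite: Bloch1972Semiregularity, Remark (7.5)]
[cite: Deligne1982HodgeCycles, §4 Remark 4.10] -/
theorem secantQuotientAnchorCarrier63Pinned_of_lefschetzDirections {C : ChernCharacterBetti}
    (h : AnchoredCarrierAt (Literature.AlgebraicGeometry.HodgeTheory.twistedReflexiveClass C
        (fun n X₀ I E => Summit.Ventures.HSemireg.gluableSigmaAdmissible n X₀ I E ∨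
          Literature.AlgebraicGeometry.HodgeTheory.bfSingleAdmissible n X₀ I E)) 6 3
      (fun X θ ↦ secantQuotientAnchorsPinned X θ)
      (fun X θ ↦ {w | w ∈ divisorClassesSpan X 6 3 ∧ w ∈ algebraicClasses X 3 ∧ IsRationalClass w ∧
        w ∉ (ℂ ∙ cupPowTwo θ 3)})) :
    SecantQuotientAnchorCarrier63Pinned C :=
  anchoredCarrierAt_anti (𝔄' := fun X θ ↦ secantQuotientAnchorsPinned X θ) (fun _ _ h ↦ h)
    (fun X θ _ ↦ secantQuotientServedClassesPinned_subset_lefschetz X θ) h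

/-- **The same for v3's (a′)** `SecantQuotientAnchorCarrier63 C`. [cite: Markman2025SecantWeil, Thm. 1.4.1 and §1.5] [cite: Bloch1972Semiregularity, Remark (7.5)] -/
theorem secantQuotientAnchorCarrier63_of_lefschetzDirections {C : ChernCharacterBetti}
    (h : AnchoredCarrierAt (Literature.AlgebraicGeometry.HodgeTheory.twistedReflexiveClass C
        (fun n X₀ I E => Summit.Ventures.HSemireg.gluableSigmaAdmissible n X₀ I E ∨
          Literature.AlgebraicGeometry.HodgeTheory.bfSingleAdmissible n X₀ I E)) 6 3
      (fun X θ ↦ secantQuotientAnchors X θ)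
      (fun X θ ↦ {w | w ∈ divisorClassesSpan X 6 3 ∧ w ∈ algebraicClasses X 3 ∧ IsRationalClass w ∧
        w ∉ (ℂ ∙ cupPowTwo θ 3)})) :
    SecantQuotientAnchorCarrier63 C :=
  anchoredCarrierAt_anti (𝔄' := fun X θ ↦ secantQuotientAnchors X θ) (fun _ _ h ↦ h)
    (fun X θ _ ↦ secantQuotientServedClasses_subset_lefschetz X θ) h

end Summit.HodgeConjecture.HodgeConjecture.Ring2.SemiregularRepresentatives

end
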